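import Literature.Probability.RandomPlanarGeometry.HexSAWKestenRenewal
import HarnessLib.Audit

/-!
# Flat calibration of `BandRenewalC` (item stmt-CriticalPhenomena-18669) — strategist s4, typed first lemmas

The half-plane (flat, empty-past) toy model of band-wise renewal is the renewal set of HEIGHTS of the critical
infinite bridge (Kesten's relation `Σ_T I_T(x_c) = 1`, in the tree as `HV.hasSum_stripIlim`; renewal equation
`HV.renewal_equation`), whose renewal function is EXACTLY `u_T = B_T(x_c) = HV.stripBlim T` and whose inter-arrival law is
`f_T = I_T(x_c) = HV.stripIlim T`.  Everything below is ANALYTIC in the two sequences (no probability space is needed):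

* `U T = Σ_{1 ≤ s ≤ T} B_s` (renewal measure of `(0, T]`),
* `firstHit T i = Σ_{0 ≤ j ≤ T} u_j f_{i-j}` (`u_0 = 1`) — the mass that the first renewal height after `T` is `i`,
* `bandHit T T' = Σ_{T < i ≤ T'} firstHit T i` — the toy-model probability of a renewal height in the band `(T, T']`.

Claimed lemmas (renewal-theory folklore; Feller XIII.3, Bertoin *Subordinators* Lemma 1.10 / Thm 3.2 for the continuum
analogue), stated as `Prop`s to be proved by whoever attacks 18669's flat case or its negation:

* `FirstHitDecomposition` : `u_k = Σ_{T < i ≤ k} firstHit T i · u_{k-i}` for `k > T` (from `renewal_equation` by induction);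
* `BandHitUpper` : `(1 + U L) · bandHit T T' ≤ U (T' + L) − U T`;
* `BandHitLower` : `U T' − U T ≤ bandHit T T' · (1 + U (T' − T))`;
* hence `FlatBandRenewal ↔ BridgeBandMass` (ratio `θ ↦ 2θ`), and `BridgeBandMass → ¬ LinearDecayCeiling`
  (band-mass forces `sup_T T·B_T(x_c) = ∞`, i.e. beating the Duminil-Copin–Smirnov lower bound `B_T ≥ m/T`,
  `HV.stripBlim_ge_div`; the upper frontier is Krachun–Panagiotis `B_T ≤ 100·T^{-10^{-10}}`).
-/

noncomputable section

open scoped BigOperators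
open Finset Filter
open Literature.Probability.RandomPlanarGeometry.SAW (HV.stripBlim HV.stripIlim)

namespace Summit.CriticalPhenomena.SAWScalingLimit.Cruxes.ObservableToSLE.FlatCalibration

/-- Renewal function with `u_0 = 1`: `u T = B_T(x_c)` for `T ≥ 1`. -/
def u (T : ℕ) : ℝ := if T = 0 then 1 else HV.stripBlim T

/-- Inter-arrival (irreducible bridge) masses, `f_0 = 0`. -/
def f (T : ℕ) : ℝ := if T = 0 then 0 else HV.stripIlim T

/-- Renewal measure of `(0, T]`: `U T = Σ_{1 ≤ s ≤ T} B_s(x_c)`. -/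
def U (T : ℕ) : ℝ := ∑ s ∈ range T, HV.stripBlim (s + 1)

/-- Mass that the FIRST renewal height after `T` equals `i` (meaningful for `i > T`). -/
def firstHit (T i : ℕ) : ℝ := ∑ j ∈ range (T + 1), u j * f (i - j)

/-- Toy-model probability of a renewal height in the band `(T, T']`. -/
def bandHit (T T' : ℕ) : ℝ := ∑ i ∈ Ioc T T', firstHit T i

/-- First-hit decomposition of the renewal function beyond `T`. -/
def FirstHitDecomposition : Prop :=
  ∀ T k : ℕ, T < k → u k = ∑ i ∈ Ioc T k, firstHit T i * u (k - i)

/-- Upper bound: a renewal in `(T, T']` is followed, on average, by `U L` further renewals within distance `L`. -/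
def BandHitUpper : Prop :=
  ∀ T T' L : ℕ, T ≤ T' → (1 + U L) * bandHit T T' ≤ U (T' + L) - U T

/-- Lower bound: every renewal in `(T, T']` comes after the first one, within distance `T' - T` of it. -/
def BandHitLower : Prop :=
  ∀ T T' : ℕ, T ≤ T' → U T' - U T ≤ bandHit T T' * (1 + U (T' - T))

/-- Flat (half-plane, empty-past) band renewal with a fixed ratio. -/
def FlatBandRenewal : Prop :=
  ∃ θ : ℕ, 2 ≤ θ ∧ ∃ p : ℝ, 0 < p ∧ ∀ᶠ T : ℕ in atTop, p ≤ bandHit T (θ * T)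

/-- Bridge band-mass at `x_c` (idea `bandwise-renewal-density`, s5): `U(θT) ≥ (1 + c)·U(T)` eventually. -/
def BridgeBandMass : Prop :=
  ∃ θ : ℕ, 2 ≤ θ ∧ ∃ c : ℝ, 0 < c ∧ ∀ᶠ T : ℕ in atTop, (1 + c) * U T ≤ U (θ * T)

/-- The Duminil-Copin–Smirnov-order ceiling `B_T(x_c) = O(1/T)` (the NEGATION target: if true, flat band renewal fails). -/
def LinearDecayCeiling : Prop :=
  ∃ M : ℝ, ∀ T : ℕ, 1 ≤ T → (T : ℝ) * HV.stripBlim T ≤ M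

/-- The calibration, as implications to be proved (all elementary given the three lemmas above and `U → ∞`,
`HV.tendsto_sum_stripBlim_atTop`). -/
def Calibration : Prop :=
  (FlatBandRenewal → BridgeBandMass) ∧ (BridgeBandMass → FlatBandRenewal) ∧ (BridgeBandMass → ¬ LinearDecayCeiling)

/-! Sanity: the objects compute on the trivial band and the statements elaborate. -/
example (T : ℕ) : bandHit T T = 0 := by simp [bandHit]
example : U 0 = 0 := by simp [U]

end Summit.CriticalPhenomena.SAWScalingLimit.Cruxes.ObservableToSLE.FlatCalibration

end
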